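import Literature.AlgebraicGeometry.HodgeTheory.QuaternionicQuarticDoublePlaneChartFactorisation
import Literature.AlgebraicGeometry.HodgeTheory.QuaternionicQuarticDoublePlaneNodalConfig
import HarnessLib

/-!
# The nodality package of the S1 programme REDUCED to conditions on `Ψ₂(a)` (every parameter)

Layer `Literature/AlgebraicGeometry/HodgeTheory`, namespace `Literature.AlgebraicGeometry.HodgeTheory.Q8Family`. Theorems only (no
definition, no named fact). Written by the prover seat `leafhand-hodge-q8symplecticpowers-4` (g5, cell `pub-hsemireg`) for the openness
step (T3) of the S1 programme of route `HodgeConjecture/Q8SymplecticPowers` (crux K1Q, stmt-HodgeConjecture-24190; consumer: the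
hypothesis `hOpen` of `Q8SymplecticPowersRegularOfNodalBasicOpen.stub_regularVeryGeneralQ_of_nodalBasicOpen`, p828906).

**`nodalPackage_of_Ψ₂_conditions`**: at a parameter `a` with `a₀² ≠ a₁²`, `a₀ + a₁ ≠ 0`, `d = (a₀² − a₁²)⁻¹`, `Ψ := planeΨ₂ a d`, the
nodality package of `hOpen` (data `(α, N) = (e, 1)`, `e` even `≥ 4`) FOLLOWS from: the coefficient of `(s²y)^{e−1}` in `Ψ` is `≠ 0`;
`Ψ = 0` and `(chartTwo 0 Ψ) = 0` are nodal, miss `y = 0` and have `∂_y ≠ 0` on the lines `s³ = s`; `(chartThree (e−1) Ψ) = 0` and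
`(chartFour (e−1) 0 Ψ) = 0` are nodal with `∂_v ≠ 0` on `s³ = s`. (Proof: the parameter-uniform chart factorisations of
`…DoublePlaneChartFactorisation`, the configuration lemmas of `…DoublePlaneNodalConfig`, and the coefficient of `s^{2e+1}y^{e}` in
`G₂ = κ·(s³y − sy)·Ψ`, which is `κ·coeff_{(2(e−1), e−1)}Ψ` by the pole bound of `Ψ`.) So T3 = «these eleven polynomial ∕ open
conditions on `ψ_a ∘ (u₀, u₁, 1)` hold on a non-empty basic open set of parameters» — non-empty by `fermatParam_nodalPackage`.
Honest scope: a reduction; nothing here bears on HC; S1 ∕ K1Q NOT proved here.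

References: [Hartshorne1977] V.2; [Fulton2008] §3.1; [Zariski1929]; [Naie2007] §1.2.
-/

noncomputable section

open MvPolynomial
open Literature.AlgebraicGeometry.PlaneCurves.SingularPointsEnvelopes Literature.AlgebraicGeometry.PlaneCurves.AffineNodalCurves
open Literature.AlgebraicGeometry.Surfaces.HirzebruchTwoDoublePlane

namespace Literature.AlgebraicGeometry.HodgeTheory.Q8Family

variable {e : ℕ} (a : CIdx e → ℂ) (d : ℂ)

/-- **The top coefficient of `G₂(a)`**: the coefficient of `s^{2e+1} y^{e}` in `G₂ = κ·(s³y − sy)·Ψ₂` is `κ` times the coefficient of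
`(s²y)^{e−1}` in `Ψ₂` (`e ≥ 1`; the `sy`-term cannot contribute by the pole bound of `Ψ₂`). [cite: Hartshorne1977, V.2 (ruled surfaces)] -/
theorem coeff_top_planeG₂ (he : 1 ≤ e) :
    coeff (Finsupp.single 0 (2 * e + 1) + Finsupp.single 1 e) (planeG₂ a d) =
      d * (coefLin a 0 + coefLin a 1) * coeff (Finsupp.single 0 (2 * (e - 1)) + Finsupp.single 1 (e - 1)) (planeΨ₂ a d) := by
  classical
  obtain ⟨k, hk⟩ : ∃ k, e = k + 1 := ⟨e - 1, by omega⟩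
  have hk' : e - 1 = k := by omega
  rw [planeG₂_eq_C_mul_cubicY_mul, hk']
  have hc : (X 0 * (X 0 - 1) * (X 0 + 1) * X 1 : MvPolynomial (Fin 2) ℂ) =
      monomial (Finsupp.single 0 3 + Finsupp.single 1 1) 1 - monomial (Finsupp.single 0 1 + Finsupp.single 1 1) 1 := by
    have h3 : (monomial (Finsupp.single 0 3 + Finsupp.single 1 1) 1 : MvPolynomial (Fin 2) ℂ) = X 0 ^ 3 * X 1 := by
      rw [X_pow_eq_monomial, X, monomial_mul, mul_one]
    have h1 : (monomial (Finsupp.single 0 1 + Finsupp.single 1 1) 1 : MvPolynomial (Fin 2) ℂ) = X 0 * X 1 := by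
      rw [X, X, monomial_mul, mul_one]
    rw [h3, h1]; ring
  rw [mul_assoc, coeff_C_mul, hc, sub_mul, coeff_sub, coeff_monomial_mul', coeff_monomial_mul', if_pos (by
    rw [hk]; intro i; fin_cases i <;> simp), if_pos (by rw [hk]; intro i; fin_cases i <;> simp), one_mul, one_mul]
  have hs1 : (Finsupp.single 0 (2 * e + 1) + Finsupp.single 1 e : Fin 2 →₀ ℕ) - (Finsupp.single 0 3 + Finsupp.single 1 1) =
      Finsupp.single 0 (2 * k) + Finsupp.single 1 k := by
    rw [hk]; ext i; fin_cases i <;> simp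
    omega
  have hs2 : (Finsupp.single 0 (2 * e + 1) + Finsupp.single 1 e : Fin 2 →₀ ℕ) - (Finsupp.single 0 1 + Finsupp.single 1 1) =
      Finsupp.single 0 (2 * k + 2) + Finsupp.single 1 k := by
    rw [hk]; ext i; fin_cases i <;> simp
    omega
  rw [hs1, hs2]
  have h0 : coeff (Finsupp.single 0 (2 * k + 2) + Finsupp.single 1 k) (planeΨ₂ a d) = 0 := by
    rw [← notMem_support_iff]
    intro hm
    have h := poleBound_planeΨ₂ a d _ hm
    simp at h
  rw [h0, sub_zero]

/-- **The nodality package of `hOpen` at `a`, from conditions on `Ψ₂(a)` alone** (`e` even `≥ 4`, `a₀² ≠ a₁²`, `a₀ + a₁ ≠ 0`,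
`d = (a₀² − a₁²)⁻¹`). [cite: Fulton2008, §3.1 (ordinary multiple points)] [cite: Hartshorne1977, V.2 (ruled surfaces)]
[cite: Zariski1929] -/
theorem nodalPackage_of_Ψ₂_conditions (he : Even e) (h4 : 4 ≤ e)
    (hdet : coefLin a 0 ^ 2 - coefLin a 1 ^ 2 ≠ 0) (hsum : coefLin a 0 + coefLin a 1 ≠ 0)
    (hd : d = (coefLin a 0 ^ 2 - coefLin a 1 ^ 2)⁻¹)
    (htop : coeff (Finsupp.single 0 (2 * (e - 1)) + Finsupp.single 1 (e - 1)) (planeΨ₂ a d) ≠ 0)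
    (h1 : IsNodal (planeΨ₂ a d)) (h1E : ∀ p : Fin 2 → ℂ, p 1 = 0 → MvPolynomial.eval p (planeΨ₂ a d) ≠ 0)
    (h1T : ∀ p : Fin 2 → ℂ, p 0 * (p 0 - 1) * (p 0 + 1) = 0 → MvPolynomial.eval p (planeΨ₂ a d) = 0 →
      grad (planeΨ₂ a d) p 1 ≠ 0)
    (h2 : IsNodal (chartTwo 0 (planeΨ₂ a d)))
    (h2E : ∀ p : Fin 2 → ℂ, p 1 = 0 → MvPolynomial.eval p (chartTwo 0 (planeΨ₂ a d)) ≠ 0)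
    (h2T : ∀ p : Fin 2 → ℂ, p 0 * (p 0 - 1) * (p 0 + 1) = 0 → MvPolynomial.eval p (chartTwo 0 (planeΨ₂ a d)) = 0 →
      grad (chartTwo 0 (planeΨ₂ a d)) p 1 ≠ 0)
    (h3 : IsNodal (chartThree (e - 1) (planeΨ₂ a d)))
    (h3T : ∀ p : Fin 2 → ℂ, p 0 * (p 0 - 1) * (p 0 + 1) = 0 → MvPolynomial.eval p (chartThree (e - 1) (planeΨ₂ a d)) = 0 →
      grad (chartThree (e - 1) (planeΨ₂ a d)) p 1 ≠ 0)
    (h4c : IsNodal (chartFour (e - 1) 0 (planeΨ₂ a d)))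
    (h4T : ∀ p : Fin 2 → ℂ, p 0 * (p 0 - 1) * (p 0 + 1) = 0 → MvPolynomial.eval p (chartFour (e - 1) 0 (planeΨ₂ a d)) = 0 →
      grad (chartFour (e - 1) 0 (planeΨ₂ a d)) p 1 ≠ 0) :
    ∃ α N : ℕ, Even α ∧ 2 ≤ α ∧
      IsChartExact α N (planeG₂ a (coefLin a 0 ^ 2 - coefLin a 1 ^ 2)⁻¹) ∧
      IsNodal (planeG₂ a (coefLin a 0 ^ 2 - coefLin a 1 ^ 2)⁻¹) ∧
      IsNodal (X 0 ^ (N % 2) * chartTwo N (planeG₂ a (coefLin a 0 ^ 2 - coefLin a 1 ^ 2)⁻¹)) ∧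
      IsNodal (chartThree α (planeG₂ a (coefLin a 0 ^ 2 - coefLin a 1 ^ 2)⁻¹)) ∧
      IsNodal (X 0 ^ (N % 2) * chartFour α N (planeG₂ a (coefLin a 0 ^ 2 - coefLin a 1 ^ 2)⁻¹)) := by
  rw [← hd]
  have he1 : 1 ≤ e := by omega
  have hdne : d ≠ 0 := by rw [hd]; exact inv_ne_zero hdet
  have hκ : d * (coefLin a 0 + coefLin a 1) ≠ 0 := mul_ne_zero hdne hsum
  refine ⟨e, 1, he, by omega, ?_, ?_, ?_, ?_, ?_⟩
  · -- exactness
    have hmem : (Finsupp.single 0 (2 * e + 1) + Finsupp.single 1 e : Fin 2 →₀ ℕ) ∈ (planeG₂ a d).support := by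
      rw [mem_support_iff, coeff_top_planeG₂ a d he1]
      exact mul_ne_zero hκ htop
    refine ⟨bounds_planeG₂ a d he1, ⟨_, hmem, by simp⟩, ⟨_, hmem, by simp; ring⟩⟩
  · -- chart U₁
    rw [planeG₂_eq_C_mul_cubicY_mul, mul_assoc]
    exact IsNodal.C_mul hκ (isNodal_cubic3_mul_X_one_mul h1 h1E h1T)
  · -- chart U₂
    rw [X_mul_chartTwo_planeG₂, mul_assoc]
    exact IsNodal.C_mul (neg_ne_zero.2 hκ) (isNodal_cubic3_mul_X_one_mul h2 h2E h2T)
  · -- chart U₃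
    rw [chartThree_planeG₂ a d he1, mul_assoc]
    exact IsNodal.C_mul hκ (isNodal_X_cube_sub_X_mul h3 h3T)
  · -- chart U₄
    rw [X_mul_chartFour_planeG₂ a d he1, mul_assoc]
    exact IsNodal.C_mul (neg_ne_zero.2 hκ) (isNodal_cubic3_mul h4c h4T)

end Literature.AlgebraicGeometry.HodgeTheory.Q8Family

end
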